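import Mathlib
import HarnessLib
import Summits.NavierStokesRegularity.NavierStokesRegularity.Theorems.HalfSpaceWindowDoorCirculationCarryingRigidityAngularFluxHourglass

/-!
# Route `HalfSpaceWindowDoor`, crux `CirculationCarryingRigidity` (stmt-NavierStokesRegularity-25311) —
# line `angular_flux` (LEAD ns-hsw-p1 g13): TIGHTNESS of the one-axis circle calculus — an explicit Gaussian HOURGLASS
# `(Γ, S)` satisfying the conservative circle law, the sign, and every class/ledger bound the Γ-lines use, with flux `Φ₀ > 0`

The companion file `…AngularFlux` shows that every door-class profile produces circle data `(Γ, S, P)` — the axis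
circulation `Γ(r,z,s) = ∮_{S(r,z)} v_θ dl` and the velocity-only angular-momentum fluxes `S = ∮v_r v_θ dl`, `P = ∮v₃ v_θ dl`
— obeying the CONSERVATIVE CIRCLE LAW `∂ₛΓ = Γ_rr − r⁻¹Γ_r + Γ_zz − (∂ᵣS + r⁻¹S + ∂_zP)` with `|S|,|P| ≤ 2πrC²/(−s)`; on the
closed hemisphere moreover `Γ ≥ 0`, `∂ᵣΓ = ∮ω₃ dl ≥ 0`, `Γ(0,·,·) = 0`, `Γ ≤ 2πrC/√(−s)`.  ALL census lines g3–g12 of this crux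
(tilt/cone/KNSS sourced swirl, eddy torque, cone/record/transport sweeping, eddy covariance, ledger pinching) argue on these
data about ONE axis.  This file exhibits, for every flux `Φ₀ > 0` and cone slope `θ`, EXPLICIT smooth data

  `Γ(r,z,t) = Φ₀ (1 − exp(−r²/(4τ)))`,  `τ = −t + θ²z²`,   `P = 0`,   `S(r,z,t) = −r⁻¹ ∫₀ʳ ρ Q(ρ,z,t) dρ`,
  `Q = (Φ₀ r² e^{−r²/4τ} / 2τ²)·(1 + θ² + θ⁴z²r²/(2τ²) − 4θ⁴z²/τ)`  (`= Γ_t − Γ_rr + r⁻¹Γ_r − Γ_zz`),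

— a vertical-vorticity flux tube of parabolic width `√(−t)` at the waist `z = 0` flaring conically (`|x_h| ≍ θ|z|`) away from
it, i.e. the «hourglass» enemy of the cards — such that (`angularFlux_hourglass_model`):
* the conservative circle law holds exactly (`t < 0`, `r ≠ 0`);
* SIGN / KINEMATICS: `Γ(0,z,t) = 0`, `0 ≤ Γ ≤ Φ₀`, `∂ᵣΓ ≥ 0` (`ω₃ ≥ 0`), `Γ ≤ Φ₀ r²/(4(−t))` (Type-I vorticity bound
  `ω₃ ≤ Φ₀/(4π(−t))`, hence also the time-only circulation bound `Γ ≤ 2πr·C/√(−t)`);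
* FLUX BOUNDS of BOTH classes: `|S| ≤ Φ₀(1+9θ²)·r/(−t)` (time-only form `2πrC²/(−t)`) and `|S| ≤ Φ₀(4+36θ²)/r`
  (space–time far-field form `2πrD²/(r+√(−t))²` up to a factor);
* CIRCULATION-CARRYING on EVERY plane: `Γ(r,z,t) → Φ₀` as `r → ∞`; HOURGLASS / tube pinching: `Γ(r,z,t) ≤ Φ₀r²/(4θ²z²)`;
* LEDGER (line `ledger`, g12), `θ ≠ 0`: the rms circulation law `(∫_{z₀−R}^{z₀+R} Γ(ρ,c,t)² dc)·log(R/ρ) ≤ πΦ₀²R/|θ|`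
  (`rms_law_model`) and the filament law `∫_{z₀−R}^{z₀+R} Γ(R,c,t) dc ≤ πΦ₀R/|θ|` (`filament_law_model`); the columnar case
  `θ = 0` fails both, matching `…Ledger.not_columnar'`.
So the conservative circle law + sign + monotonicity + axis vanishing + the Type-I circulation/vorticity/flux bounds (time-only
and space–time) + finite flux + the ledger's rms and filament laws do NOT imply `Γ ≡ 0`: any proof of W6 (`HemisphereLiouvilleE3`) must use information that
couples the fluxes `S, P` to the velocity field beyond these budgets (Biot–Savart / pressure / several axes / pointwise
structure).  This is a statement about the METHOD (genre of `…Tightness`, g2), not about Navier–Stokes: the data do not come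
from a velocity field and nothing is refuted.  Pure real analysis (Mathlib only); no new definitions.

Seat ns-hsw-p1 g13 (LEAD of 25311, cell pub-ns-dss), `--supports stmt-NavierStokesRegularity-25311 --as helper`.
WHAT THIS IS NOT: not a statement about Navier–Stokes regularity (Clay A) and not a refutation of the stub; door statements
concern HYPOTHETICAL blow-up profiles; the item stays OPEN at its research stub; nothing is closed by this file.
-/

noncomputable section

-- the summit and its single sub-problem share the name (CONVENTIONS §1), as in every Theorems file
set_option linter.dupNamespace false

namespace Summit.NavierStokesRegularity.NavierStokesRegularity.Theorems.HalfSpaceWindowDoorCirculationCarryingRigidityAngularFluxTightness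

open Set Filter Topology intervalIntegral MeasureTheory
open Summit.NavierStokesRegularity.NavierStokesRegularity.Theorems.HalfSpaceWindowDoorCirculationCarryingRigidityAngularFluxHourglass

/-! ### The ledger's rms circulation law on the model (window integrals of `Γ²`) -/

/-- Lorentzian majorant of the profile: for `Φ ≥ 0`, `t < 0`, `Γ(ρ,c,t) ≤ 2Φρ²/(ρ² + 4θ²c²)`
(from `0 ≤ Γ ≤ Φ`, `Γ ≤ Φρ²/(4τ)`, `τ = −t + θ²c² ≥ θ²c²`). -/
theorem model_le_lorentz {Φ : ℝ} (hΦ : 0 ≤ Φ) (θ ρ c : ℝ) {t : ℝ} (ht : t < 0) :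
    Φ * (1 - Real.exp (-(ρ ^ 2) / (4 * (-t + θ ^ 2 * c ^ 2)))) ≤ 2 * Φ * ρ ^ 2 / (ρ ^ 2 + 4 * θ ^ 2 * c ^ 2) := by
  by_cases hρ : ρ = 0
  · subst hρ; simp
  have hτ := tau_pos θ c ht
  have hτm : θ ^ 2 * c ^ 2 ≤ -t + θ ^ 2 * c ^ 2 := by linarith
  obtain ⟨h0, h1, h2⟩ := model_bounds hΦ hτ ρ
  set τ := -t + θ ^ 2 * c ^ 2 with hτdef
  set Γ := Φ * (1 - Real.exp (-(ρ ^ 2) / (4 * τ))) with hΓ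
  have h3 : Γ * (4 * τ) ≤ Φ * ρ ^ 2 :=
    calc Γ * (4 * τ) ≤ Φ * (ρ ^ 2 / (4 * τ)) * (4 * τ) := mul_le_mul_of_nonneg_right h2 (by positivity)
      _ = Φ * ρ ^ 2 := by field_simp
  have h4 : Γ * ρ ^ 2 ≤ Φ * ρ ^ 2 := mul_le_mul_of_nonneg_right h1 (sq_nonneg ρ)
  have hpos : 0 < ρ ^ 2 + 4 * θ ^ 2 * c ^ 2 := by positivity
  rw [le_div_iff₀ hpos]
  nlinarith [mul_nonneg h0 (sub_nonneg.mpr hτm)]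

/-- Lorentzian majorant of the squared profile: `Γ(ρ,c,t)² ≤ 2Φ²ρ²/(ρ² + 4θ²c²)` (`Γ² ≤ ΦΓ`). -/
theorem sq_model_le {Φ : ℝ} (hΦ : 0 ≤ Φ) (θ ρ c : ℝ) {t : ℝ} (ht : t < 0) :
    (Φ * (1 - Real.exp (-(ρ ^ 2) / (4 * (-t + θ ^ 2 * c ^ 2))))) ^ 2 ≤ 2 * Φ ^ 2 * ρ ^ 2 / (ρ ^ 2 + 4 * θ ^ 2 * c ^ 2) := by
  have h := model_le_lorentz hΦ θ ρ c ht
  obtain ⟨h0, h1, -⟩ := model_bounds hΦ (tau_pos θ c ht) ρ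
  calc (Φ * (1 - Real.exp (-(ρ ^ 2) / (4 * (-t + θ ^ 2 * c ^ 2))))) ^ 2
      ≤ Φ * (Φ * (1 - Real.exp (-(ρ ^ 2) / (4 * (-t + θ ^ 2 * c ^ 2))))) := by rw [sq]; gcongr
    _ ≤ Φ * (2 * Φ * ρ ^ 2 / (ρ ^ 2 + 4 * θ ^ 2 * c ^ 2)) := mul_le_mul_of_nonneg_left h hΦ
    _ = 2 * Φ ^ 2 * ρ ^ 2 / (ρ ^ 2 + 4 * θ ^ 2 * c ^ 2) := by ring

/-- `∫ₐᵇ 2ρ²/(ρ² + 4θ²c²) dc ≤ πρ/|θ|` for `ρ > 0`, `θ ≠ 0` (arctangent primitive; any `a, b`). -/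
theorem integral_lorentz_le {ρ θ : ℝ} (hρ : 0 < ρ) (hθ : θ ≠ 0) (a b : ℝ) :
    ∫ c in a..b, 2 * ρ ^ 2 / (ρ ^ 2 + 4 * θ ^ 2 * c ^ 2) ≤ Real.pi * ρ / |θ| := by
  have hθ' : 0 < |θ| := abs_pos.mpr hθ
  have hF : ∀ c : ℝ, HasDerivAt (fun c' => ρ / |θ| * Real.arctan (2 * |θ| * c' / ρ))
      (2 * ρ ^ 2 / (ρ ^ 2 + 4 * θ ^ 2 * c ^ 2)) c := fun c => by
    have h1 : HasDerivAt (fun c' => 2 * |θ| * c' / ρ) (2 * |θ| / ρ) c := by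
      simpa using ((hasDerivAt_id c).const_mul (2 * |θ|)).div_const ρ
    refine ((h1.arctan).const_mul (ρ / |θ|)).congr_deriv ?_
    have hθ2 : |θ| ^ 2 = θ ^ 2 := sq_abs θ
    field_simp
    rw [hθ2]
    ring
  have hc : Continuous fun c : ℝ => 2 * ρ ^ 2 / (ρ ^ 2 + 4 * θ ^ 2 * c ^ 2) := by
    refine Continuous.div continuous_const (by fun_prop) fun c => ?_
    positivity
  rw [integral_eq_sub_of_hasDerivAt (fun c _ => hF c) (hc.intervalIntegrable _ _)]
  have hb := Real.arctan_lt_pi_div_two (2 * |θ| * b / ρ)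
  have ha := Real.neg_pi_div_two_lt_arctan (2 * |θ| * a / ρ)
  rw [← mul_sub]
  calc ρ / |θ| * (Real.arctan (2 * |θ| * b / ρ) - Real.arctan (2 * |θ| * a / ρ))
      ≤ ρ / |θ| * Real.pi := mul_le_mul_of_nonneg_left (by linarith) (by positivity)
    _ = Real.pi * ρ / |θ| := by ring

/-- **The ledger's RMS CIRCULATION LAW holds for the model** (`θ ≠ 0`): for every window of half-width `R > 0` about any height
`z₀`, every radius `ρ > 0` and `t < 0`, `(∫_{z₀−R}^{z₀+R} Γ(ρ,c,t)² dc)·log(R/ρ) ≤ πΦ²R/|θ|`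
(cf. `…Ledger.exists_circ_sq_integral_mul_log_le`: `≤ 4πK(C)R`). -/
theorem rms_law_model {Φ : ℝ} (hΦ : 0 ≤ Φ) {θ : ℝ} (hθ : θ ≠ 0) {t : ℝ} (ht : t < 0) (z₀ : ℝ) {R ρ : ℝ}
    (hR : 0 < R) (hρ : 0 < ρ) :
    (∫ c in (z₀ - R)..(z₀ + R), (Φ * (1 - Real.exp (-(ρ ^ 2) / (4 * (-t + θ ^ 2 * c ^ 2))))) ^ 2) * Real.log (R / ρ)
      ≤ Real.pi * Φ ^ 2 * R / |θ| := by
  have hθ' : 0 < |θ| := abs_pos.mpr hθ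
  have hwin : z₀ - R ≤ z₀ + R := by linarith
  have hcont : Continuous fun c : ℝ => (Φ * (1 - Real.exp (-(ρ ^ 2) / (4 * (-t + θ ^ 2 * c ^ 2))))) ^ 2 := by
    refine Continuous.pow (continuous_const.mul (continuous_const.sub (Real.continuous_exp.comp ?_))) 2
    refine Continuous.div continuous_const (by fun_prop) fun c => ?_
    exact (mul_pos (by norm_num : (0:ℝ) < 4) (tau_pos θ c ht)).ne'
  have hmaj : Continuous fun c : ℝ => 2 * Φ ^ 2 * ρ ^ 2 / (ρ ^ 2 + 4 * θ ^ 2 * c ^ 2) := by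
    refine Continuous.div continuous_const (by fun_prop) fun c => ?_
    positivity
  have hmono : ∫ c in (z₀ - R)..(z₀ + R), (Φ * (1 - Real.exp (-(ρ ^ 2) / (4 * (-t + θ ^ 2 * c ^ 2))))) ^ 2
      ≤ ∫ c in (z₀ - R)..(z₀ + R), 2 * Φ ^ 2 * ρ ^ 2 / (ρ ^ 2 + 4 * θ ^ 2 * c ^ 2) :=
    intervalIntegral.integral_mono_on hwin (hcont.intervalIntegrable _ _) (hmaj.intervalIntegrable _ _)
      fun c _ => sq_model_le hΦ θ ρ c ht
  have hfac : ∫ c in (z₀ - R)..(z₀ + R), 2 * Φ ^ 2 * ρ ^ 2 / (ρ ^ 2 + 4 * θ ^ 2 * c ^ 2)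
      = Φ ^ 2 * ∫ c in (z₀ - R)..(z₀ + R), 2 * ρ ^ 2 / (ρ ^ 2 + 4 * θ ^ 2 * c ^ 2) := by
    rw [← intervalIntegral.integral_const_mul]
    exact intervalIntegral.integral_congr fun c _ => by ring
  have hI : ∫ c in (z₀ - R)..(z₀ + R), (Φ * (1 - Real.exp (-(ρ ^ 2) / (4 * (-t + θ ^ 2 * c ^ 2))))) ^ 2
      ≤ Φ ^ 2 * (Real.pi * ρ / |θ|) := by
    rw [hfac] at hmono
    exact hmono.trans (mul_le_mul_of_nonneg_left (integral_lorentz_le hρ hθ _ _) (sq_nonneg Φ))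
  have hI0 : 0 ≤ ∫ c in (z₀ - R)..(z₀ + R), (Φ * (1 - Real.exp (-(ρ ^ 2) / (4 * (-t + θ ^ 2 * c ^ 2))))) ^ 2 :=
    intervalIntegral.integral_nonneg hwin fun c _ => sq_nonneg _
  rcases le_or_gt (Real.log (R / ρ)) 0 with hlog | hlog
  · calc _ ≤ (0 : ℝ) := mul_nonpos_of_nonneg_of_nonpos hI0 hlog
      _ ≤ Real.pi * Φ ^ 2 * R / |θ| := by positivity
  · have hlog' : Real.log (R / ρ) ≤ R / ρ := (Real.log_le_sub_one_of_pos (by positivity)).trans (by linarith)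
    calc _ ≤ Φ ^ 2 * (Real.pi * ρ / |θ|) * (R / ρ) := mul_le_mul hI hlog' hlog.le (by positivity)
      _ = Real.pi * Φ ^ 2 * R / |θ| := by field_simp

/-- **The ledger's FILAMENT LAW holds for the model** (`θ ≠ 0`): the vertical vorticity in a cylinder of radius and
half-height `R` is `O(R)`: `∫_{z₀−R}^{z₀+R} Γ(R,c,t) dc ≤ πΦR/|θ|` for all `R > 0`, `z₀`, `t < 0`
(cf. `…LedgerFilament.exists_integral_ball_inner_curl_e3_le`: `∫_{B_R}ω₃ ≤ K_f R`). -/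
theorem filament_law_model {Φ : ℝ} (hΦ : 0 ≤ Φ) {θ : ℝ} (hθ : θ ≠ 0) {t : ℝ} (ht : t < 0) (z₀ : ℝ) {R : ℝ}
    (hR : 0 < R) :
    ∫ c in (z₀ - R)..(z₀ + R), Φ * (1 - Real.exp (-(R ^ 2) / (4 * (-t + θ ^ 2 * c ^ 2)))) ≤ Real.pi * Φ * R / |θ| := by
  have hwin : z₀ - R ≤ z₀ + R := by linarith
  have hcont : Continuous fun c : ℝ => Φ * (1 - Real.exp (-(R ^ 2) / (4 * (-t + θ ^ 2 * c ^ 2)))) := by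
    refine continuous_const.mul (continuous_const.sub (Real.continuous_exp.comp ?_))
    refine Continuous.div continuous_const (by fun_prop) fun c => ?_
    exact (mul_pos (by norm_num : (0:ℝ) < 4) (tau_pos θ c ht)).ne'
  have hmaj : Continuous fun c : ℝ => 2 * Φ * R ^ 2 / (R ^ 2 + 4 * θ ^ 2 * c ^ 2) := by
    refine Continuous.div continuous_const (by fun_prop) fun c => ?_
    positivity
  have hmono : ∫ c in (z₀ - R)..(z₀ + R), Φ * (1 - Real.exp (-(R ^ 2) / (4 * (-t + θ ^ 2 * c ^ 2))))
      ≤ ∫ c in (z₀ - R)..(z₀ + R), 2 * Φ * R ^ 2 / (R ^ 2 + 4 * θ ^ 2 * c ^ 2) :=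
    intervalIntegral.integral_mono_on hwin (hcont.intervalIntegrable _ _) (hmaj.intervalIntegrable _ _)
      fun c _ => model_le_lorentz hΦ θ R c ht
  have hfac : ∫ c in (z₀ - R)..(z₀ + R), 2 * Φ * R ^ 2 / (R ^ 2 + 4 * θ ^ 2 * c ^ 2)
      = Φ * ∫ c in (z₀ - R)..(z₀ + R), 2 * R ^ 2 / (R ^ 2 + 4 * θ ^ 2 * c ^ 2) := by
    rw [← intervalIntegral.integral_const_mul]
    exact intervalIntegral.integral_congr fun c _ => by ring
  rw [hfac] at hmono
  calc _ ≤ Φ * (Real.pi * R / |θ|) := hmono.trans (mul_le_mul_of_nonneg_left (integral_lorentz_le hR hθ _ _) hΦ)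
    _ = Real.pi * Φ * R / |θ| := by ring

/-! ### The hourglass model: all budgets of the one-axis circle calculus, and `Φ₀ > 0` -/

/-- **TIGHTNESS OF THE ONE-AXIS CIRCLE CALCULUS — THE HOURGLASS MODEL.**  For every flux `Φ > 0` and cone slope `θ`
there are smooth circle data `Γ, S, P : (r, z, t) ↦ ℝ` (explicitly: `Γ = Φ(1 − e^{−r²/4τ})`, `τ = −t + θ²z²`,
`S = −r⁻¹∫₀ʳρQ`, `P = 0`, see the module docstring) such that, for all `t < 0`:
1. (LAW) the conservative circle law `∂ₜΓ = Γ_rr − r⁻¹Γ_r + Γ_zz − (∂ᵣS + r⁻¹S + ∂_zP)` holds at every `r ≠ 0`, `z`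
   (the shape of `…AngularFlux.circ_conservation_law_of_class`);
2. (AXIS) `Γ(0,z,t) = 0`;  3. (SIGN `ω₃ ≥ 0`) `∂ᵣΓ ≥ 0` for `r ≥ 0`;
4. (TYPE-I BOUNDS) `0 ≤ Γ ≤ Φ` and `Γ ≤ Φ r²/(4(−t))` (vorticity bound `ω₃ ≤ Φ/(4π(−t))`; finite flux);
5. (FLUX BOUNDS, both classes) `|S| ≤ Φ(1+9θ²) r/(−t)` and `|S| ≤ Φ(4+36θ²)/r` for `r > 0`;  6. `P ≡ 0`;
7. (CIRCULATION-CARRYING) `Γ(r,z,t) → Φ` as `r → ∞` on EVERY plane;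
8. (HOURGLASS / TUBE PINCHING) `Γ(r,z,t) ≤ Φ r²/(4θ²z²)` whenever `θ z ≠ 0`;
9. (NON-TRIVIAL) `Γ(r,z,t) > 0` for `r ≠ 0`;
10. (LEDGER RMS LAW, `θ ≠ 0`) `(∫_{z₀−R}^{z₀+R} Γ(ρ,c,t)² dc)·log(R/ρ) ≤ πΦ²R/|θ|` for all windows (`…Ledger`'s rms circulation law);
11. (LEDGER FILAMENT LAW, `θ ≠ 0`) `∫_{z₀−R}^{z₀+R} Γ(R,c,t) dc ≤ πΦR/|θ|` (`…LedgerFilament`: `∫_{B_R}ω₃ ≤ K_f R`).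
Hence these budgets — all that the Γ-lines of this crux extract from the door class about one axis — do not force `Γ ≡ 0`. -/
theorem angularFlux_hourglass_model {Φ : ℝ} (hΦ : 0 < Φ) (θ : ℝ) :
    ∃ Γ S P : ℝ → ℝ → ℝ → ℝ,
      (∀ t < 0, ∀ r ≠ 0, ∀ z : ℝ, deriv (fun t' => Γ r z t') t
          = deriv (fun r' => deriv (fun r'' => Γ r'' z t) r') r - r⁻¹ * deriv (fun r' => Γ r' z t) r
            + deriv (fun z' => deriv (fun z'' => Γ r z'' t) z') z
            - (deriv (fun r' => S r' z t) r + r⁻¹ * S r z t + deriv (fun z' => P r z' t) z)) ∧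
      (∀ z t : ℝ, Γ 0 z t = 0) ∧
      (∀ t < 0, ∀ z r : ℝ, 0 ≤ r → 0 ≤ deriv (fun r' => Γ r' z t) r) ∧
      (∀ t < 0, ∀ z r : ℝ, 0 ≤ Γ r z t ∧ Γ r z t ≤ Φ ∧ Γ r z t ≤ Φ * r ^ 2 / (4 * (-t))) ∧
      (∀ t < 0, ∀ z r : ℝ, 0 < r →
          |S r z t| ≤ Φ * (1 + 9 * θ ^ 2) * r / (-t) ∧ |S r z t| ≤ Φ * (4 + 36 * θ ^ 2) / r) ∧
      (∀ r z t : ℝ, P r z t = 0) ∧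
      (∀ t < 0, ∀ z : ℝ, Tendsto (fun r => Γ r z t) atTop (𝓝 Φ)) ∧
      (∀ t < 0, ∀ z r : ℝ, θ * z ≠ 0 → Γ r z t ≤ Φ * r ^ 2 / (4 * (θ ^ 2 * z ^ 2))) ∧
      (∀ t < 0, ∀ z r : ℝ, r ≠ 0 → 0 < Γ r z t) ∧
      (θ ≠ 0 → ∀ t < 0, ∀ z₀ R ρ : ℝ, 0 < R → 0 < ρ →
          (∫ c in (z₀ - R)..(z₀ + R), (Γ ρ c t) ^ 2) * Real.log (R / ρ) ≤ Real.pi * Φ ^ 2 * R / |θ|) ∧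
      (θ ≠ 0 → ∀ t < 0, ∀ z₀ R : ℝ, 0 < R →
          ∫ c in (z₀ - R)..(z₀ + R), Γ R c t ≤ Real.pi * Φ * R / |θ|) := by
  refine ⟨fun r z t => Φ * (1 - Real.exp (-(r ^ 2) / (4 * (-t + θ ^ 2 * z ^ 2)))),
    fun r z t => -(∫ ρ in (0 : ℝ)..r, ρ * (Φ * ρ ^ 2 * Real.exp (-(ρ ^ 2) / (4 * (-t + θ ^ 2 * z ^ 2)))
          / (2 * (-t + θ ^ 2 * z ^ 2) ^ 2) * (1 + θ ^ 2 + θ ^ 4 * z ^ 2 * ρ ^ 2 / (2 * (-t + θ ^ 2 * z ^ 2) ^ 2)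
            - 4 * θ ^ 4 * z ^ 2 / (-t + θ ^ 2 * z ^ 2)))) / r,
    fun _ _ _ => 0, ?_, ?_, ?_, ?_, ?_, fun _ _ _ => rfl, ?_, ?_, ?_, ?_, ?_⟩
  · -- 1. the conservative circle law
    intro t ht r hr z
    have hτ := tau_pos θ z ht
    have hτ0 := hτ.ne'
    simp only
    have h1 := (hasDerivAt_model_t Φ θ r z ht).deriv
    have hdr : deriv (fun r' => Φ * (1 - Real.exp (-(r' ^ 2) / (4 * (-t + θ ^ 2 * z ^ 2)))))
        = fun r' => Φ * Real.exp (-(r' ^ 2) / (4 * (-t + θ ^ 2 * z ^ 2))) * r' / (2 * (-t + θ ^ 2 * z ^ 2)) :=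
      funext fun r' => (hasDerivAt_model_r Φ (-t + θ ^ 2 * z ^ 2) r').deriv
    have h2 := (hasDerivAt_model_rr Φ (-t + θ ^ 2 * z ^ 2) r).deriv
    have hdz : deriv (fun z' => Φ * (1 - Real.exp (-(r ^ 2) / (4 * (-t + θ ^ 2 * z' ^ 2)))))
        = fun z' => -(Φ * Real.exp (-(r ^ 2) / (4 * (-t + θ ^ 2 * z' ^ 2))) * r ^ 2 * θ ^ 2 * z'
            / (2 * (-t + θ ^ 2 * z' ^ 2) ^ 2)) :=
      funext fun z' => (hasDerivAt_model_z Φ θ r ht z').deriv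
    have h3 := (hasDerivAt_model_zz Φ θ r ht z).deriv
    have h4 := flux_divergence Φ θ z t hr
    rw [h1, hdr, h2, hdz, h3, deriv_const]
    simp only
    have hkey : Φ * Real.exp (-(r ^ 2) / (4 * (-t + θ ^ 2 * z ^ 2))) * r ^ 2 / (4 * (-t + θ ^ 2 * z ^ 2) ^ 2)
        = Φ * Real.exp (-(r ^ 2) / (4 * (-t + θ ^ 2 * z ^ 2))) * (1 / (2 * (-t + θ ^ 2 * z ^ 2))
              - r ^ 2 / (4 * (-t + θ ^ 2 * z ^ 2) ^ 2))
          - r⁻¹ * (Φ * Real.exp (-(r ^ 2) / (4 * (-t + θ ^ 2 * z ^ 2))) * r / (2 * (-t + θ ^ 2 * z ^ 2)))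
          + -(Φ * r ^ 2 * θ ^ 2 * Real.exp (-(r ^ 2) / (4 * (-t + θ ^ 2 * z ^ 2))) / (2 * (-t + θ ^ 2 * z ^ 2) ^ 2)
              * (1 + r ^ 2 * θ ^ 2 * z ^ 2 / (2 * (-t + θ ^ 2 * z ^ 2) ^ 2) - 4 * θ ^ 2 * z ^ 2 / (-t + θ ^ 2 * z ^ 2)))
          - (-(Φ * r ^ 2 * Real.exp (-(r ^ 2) / (4 * (-t + θ ^ 2 * z ^ 2))) / (2 * (-t + θ ^ 2 * z ^ 2) ^ 2)
              * (1 + θ ^ 2 + θ ^ 4 * z ^ 2 * r ^ 2 / (2 * (-t + θ ^ 2 * z ^ 2) ^ 2)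
                  - 4 * θ ^ 4 * z ^ 2 / (-t + θ ^ 2 * z ^ 2))) + 0) := by
      field_simp
      ring
    linarith [hkey, h4]
  · -- 2. axis
    intro z t; simp
  · -- 3. sign
    intro t ht z r hr
    have hτ := tau_pos θ z ht
    simp only
    rw [(hasDerivAt_model_r Φ (-t + θ ^ 2 * z ^ 2) r).deriv]
    have := Real.exp_pos (-(r ^ 2) / (4 * (-t + θ ^ 2 * z ^ 2)))
    positivity
  · -- 4. Type-I bounds
    intro t ht z r
    have hτ := tau_pos θ z ht
    obtain ⟨h0, h1, h2⟩ := model_bounds hΦ.le hτ r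
    refine ⟨h0, h1, h2.trans ?_⟩
    rw [mul_div_assoc]
    refine mul_le_mul_of_nonneg_left ?_ hΦ.le
    exact div_le_div_of_nonneg_left (sq_nonneg r) (by linarith) (by nlinarith [sq_nonneg (θ * z)])
  · -- 5. flux bounds
    intro t ht z r hr
    have hτ := tau_pos θ z ht
    obtain ⟨hA, hB⟩ := abs_fluxIntegral_le hΦ.le θ z ht hr.le
    simp only
    rw [abs_div, abs_neg, abs_of_pos hr]
    have ht' : 0 < -t := neg_pos.mpr ht
    have hm : 0 ≤ θ ^ 2 * z ^ 2 := by positivity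
    constructor
    · calc _ ≤ Φ * (1 + 9 * θ ^ 2) * r ^ 2 / (-t + θ ^ 2 * z ^ 2) / r := div_le_div_of_nonneg_right hB hr.le
        _ = Φ * (1 + 9 * θ ^ 2) * r / (-t + θ ^ 2 * z ^ 2) := by field_simp
        _ ≤ Φ * (1 + 9 * θ ^ 2) * r / (-t) := div_le_div_of_nonneg_left (by positivity) ht' (by linarith)
    · exact div_le_div_of_nonneg_right hA hr.le
  · -- 7. circulation-carrying on every plane
    intro t ht z
    exact tendsto_model (tau_pos θ z ht) Φ
  · -- 8. hourglass pinching
    intro t ht z r hθz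
    have hτ := tau_pos θ z ht
    have hm : 0 < θ ^ 2 * z ^ 2 := by rw [← mul_pow]; positivity
    obtain ⟨-, -, h2⟩ := model_bounds hΦ.le hτ r
    refine h2.trans ?_
    rw [mul_div_assoc]
    refine mul_le_mul_of_nonneg_left ?_ hΦ.le
    exact div_le_div_of_nonneg_left (sq_nonneg r) (by positivity) (by nlinarith)
  · -- 9. non-trivial
    intro t ht z r hr
    have hτ := tau_pos θ z ht
    simp only
    have hu : -(r ^ 2) / (4 * (-t + θ ^ 2 * z ^ 2)) < 0 := by
      rw [neg_div]; exact neg_neg_of_pos (by positivity)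
    have := Real.exp_lt_one_iff.mpr hu
    nlinarith
  · -- 10. the ledger's rms circulation law
    intro hθ t ht z₀ R ρ hR hρ
    exact rms_law_model hΦ.le hθ ht z₀ hR hρ
  · -- 11. the ledger's filament law
    intro hθ t ht z₀ R hR
    exact filament_law_model hΦ.le hθ ht z₀ hR

end Summit.NavierStokesRegularity.NavierStokesRegularity.Theorems.HalfSpaceWindowDoorCirculationCarryingRigidityAngularFluxTightness

end
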